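import Mathlib
import Summits.ValiantsHypothesis.ValiantsHypothesis.Theorems.BarrierLeverTransversalMinorLayoutsLowerSets

/-!
# Route BarrierLever — conjecture TT (stmt-ValiantsHypothesis-19152): reduction to simplicial
# complexes, part 2 — the SAME-SIZE form and vertex degrees

Companion of `…TransversalMinorLayoutsLowerSets` (p448941; seat val-np-p2 gen 3).  The reduction of
TT to pairs of lower sets given there is stated level-wise (fixed `h`, all sizes `r` at once).  The
R1 induction (literal-pair split, items 19587 / 19617) is a strong induction on the layout size `r`
inside a fixed dimension, so it needs the reduction at FIXED `h` AND `r`: down-compressions never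
change the number of members, and the proof is the same (`tt_sameSize_of_lowerSets`).  For complexes
the class sizes appearing in R1 are vertex degrees: `card_filter_mem_le_of_isLowerSet` records
`#{i : a ∈ u i} ≤ #{i : a ∉ u i}` (erase `a`), so after the lower-set reduction the R1-irreducible
pairs are exactly the pairs of complexes with equal face numbers and disjoint vertex-degree sets.

Definition-free.  WHAT THIS IS NOT: no proof of TT; nothing on crux 14610 or VP versus VNP.
-/

-- layout Summits/ValiantsHypothesis/ValiantsHypothesis forces the duplicated namespace component
set_option linter.dupNamespace false

open Matrix Finset

namespace Summit.ValiantsHypothesis.ValiantsHypothesis.Theorems.BarrierLever.Compression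

/-! ## 1. Same-size reduction and vertex degrees of complexes -/

/-- SAME-SIZE REDUCTION.  Fix `h` and `r`.  If the TT layout matrix is nonsingular (for some `H`) for
every pair of injective layouts `Fin r → Finset (Fin h)` whose ranges are lower sets, then it is
nonsingular for every pair of injective layouts `Fin r → Finset (Fin h)`: down-compressions keep the
number of members, so the reduction of `tt_level_of_lowerSets` never leaves size `r` (this is the
form used by a strong induction on `r` together with the literal-pair split R1, item 19587). -/
theorem tt_sameSize_of_lowerSets (h r : ℕ)
    (hyp : ∀ (u w : Fin r → Finset (Fin h)), Function.Injective u →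
      Function.Injective w → IsLowerSet (Set.range u) → IsLowerSet (Set.range w) →
      ∃ H : Matrix (Fin (h + h)) (Fin (h + h)) ℂ, (Matrix.of fun i j : Fin r => (H.submatrix
        (fun b : Fin h => if b ∈ u i then Fin.castAdd h b else Fin.natAdd h b)
        (fun b : Fin h => if b ∈ w j then Fin.natAdd h b else Fin.castAdd h b)).det).det ≠ 0)
    (u w : Fin r → Finset (Fin h)) (hu : Function.Injective u) (hw : Function.Injective w) :
    ∃ H : Matrix (Fin (h + h)) (Fin (h + h)) ℂ, (Matrix.of fun i j : Fin r => (H.submatrix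
      (fun b : Fin h => if b ∈ u i then Fin.castAdd h b else Fin.natAdd h b)
      (fun b : Fin h => if b ∈ w j then Fin.natAdd h b else Fin.castAdd h b)).det).det ≠ 0 := by
  classical
  suffices key : ∀ (N : ℕ) (u w : Fin r → Finset (Fin h)), Function.Injective u →
      Function.Injective w → (∑ i, (u i).card) + (∑ j, (w j).card) ≤ N →
      ∃ H : Matrix (Fin (h + h)) (Fin (h + h)) ℂ, (Matrix.of fun i j : Fin r => (H.submatrix
        (fun b : Fin h => if b ∈ u i then Fin.castAdd h b else Fin.natAdd h b)
        (fun b : Fin h => if b ∈ w j then Fin.natAdd h b else Fin.castAdd h b)).det).det ≠ 0 from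
    key _ u w hu hw le_rfl
  intro N
  induction N with
  | zero =>
    intro u w hu hw hN
    have hu0 : ∀ i, u i = ∅ := by
      intro i
      have : (u i).card = 0 := by
        have h1 : (u i).card ≤ ∑ i, (u i).card :=
          Finset.single_le_sum (f := fun i => (u i).card) (fun i _ => Nat.zero_le _)
            (Finset.mem_univ i)
        omega
      exact Finset.card_eq_zero.mp this
    have hw0 : ∀ j, w j = ∅ := by
      intro j
      have : (w j).card = 0 := by
        have h1 : (w j).card ≤ ∑ j, (w j).card :=
          Finset.single_le_sum (f := fun j => (w j).card) (fun j _ => Nat.zero_le _)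
            (Finset.mem_univ j)
        omega
      exact Finset.card_eq_zero.mp this
    refine hyp u w hu hw ?_ ?_
    · exact isLowerSet_range_of_forall_erase_mem u (fun i a ha => by simp [hu0 i] at ha)
    · exact isLowerSet_range_of_forall_erase_mem w (fun j c hc => by simp [hw0 j] at hc)
  | succ N ih =>
    intro u w hu hw hN
    by_cases hcu : ∀ i a, a ∈ u i → (u i).erase a ∈ Finset.univ.image u
    · by_cases hcw : ∀ j c, c ∈ w j → (w j).erase c ∈ Finset.univ.image w
      · exact hyp u w hu hw (isLowerSet_range_of_forall_erase_mem u hcu)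
          (isLowerSet_range_of_forall_erase_mem w hcw)
      · push Not at hcw
        obtain ⟨j₀, c, hc, hnot⟩ := hcw
        refine tt_layout_of_col_compression h r u w c (ih u _ hu (downCompress_injective w hw c) ?_)
        have hlt := sum_card_downCompress_lt w c j₀ ⟨hc, hnot⟩
        omega
    · push Not at hcu
      obtain ⟨i₀, a, ha, hnot⟩ := hcu
      refine tt_layout_of_row_compression h r u w a (ih _ w (downCompress_injective u hu a) hw ?_)
      have hlt := sum_card_downCompress_lt u a i₀ ⟨ha, hnot⟩
      omega

/-- In a lower-set layout the class of members containing a vertex is at most as large as the class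
of members avoiding it (`s ↦ s.erase a` injects the former into the latter); so for complexes the
literal-pair class sizes of R1 are the vertex degrees `d(a) ≤ r/2` and their complements. -/
theorem card_filter_mem_le_of_isLowerSet {h r : ℕ} (u : Fin r → Finset (Fin h))
    (hu : Function.Injective u) (hl : IsLowerSet (Set.range u)) (a : Fin h) :
    (Finset.univ.filter fun i => a ∈ u i).card ≤ (Finset.univ.filter fun i => a ∉ u i).card := by
  classical
  -- the erased copy of a member containing `a` is a member avoiding `a`
  have hex : ∀ i, a ∈ u i → ∃ i', u i' = (u i).erase a := by
    intro i hai
    have hmem : (u i).erase a ∈ Set.range u :=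
      hl (show (u i).erase a ≤ u i from Finset.erase_subset a (u i)) ⟨i, rfl⟩
    obtain ⟨i', hi'⟩ := hmem
    exact ⟨i', hi'⟩
  choose! e he using hex
  refine Finset.card_le_card_of_injOn e ?_ ?_
  · intro i hi
    simp only [Finset.coe_filter, Set.mem_setOf_eq, Finset.mem_univ, true_and] at hi ⊢
    rw [he i hi]
    exact Finset.notMem_erase a (u i)
  · intro i hi j hj hij
    simp only [Finset.coe_filter, Set.mem_setOf_eq, Finset.mem_univ, true_and] at hi hj
    apply hu
    rw [← Finset.insert_erase hi, ← Finset.insert_erase hj, ← he i hi, ← he j hj, hij]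

end Summit.ValiantsHypothesis.ValiantsHypothesis.Theorems.BarrierLever.Compression
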